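import Summits.Ventures.Crystal3D.Theorems.StickyWulffConstantCoaxialWallLawModuleContactsBridge
import HarnessLib

/-!
# FOUR BARLOW CONTACTS FORCE A MODULE POINT, III: the core theorem in module coordinates (crux `CoaxialWallLaw`, stmt-Ventures-19481,
# line `WallLedgerF`; rigidity lemma of the line of `stub_multiGrainSmallHigh`)

HONEST FRAMING. Venture `Summits/Ventures/Crystal3D` (cell `crystal3d-full`), helper `--supports` the crux `CoaxialWallLaw` of
`route-Ventures-StickyWulffConstant` (REGISTERED line `WallLedgerF`, skeleton 'CoaxialWallLawCertificates' v4, stub `stub_multiGrainSmallHigh`).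
Rung credit only; F-C1 not moved; census-free.  On top of `…ModuleContactsTable` (kernel table) and `…ModuleContactsBridge` (real algebra):
* `okPair_iff`, `exists_menu_of_check` (dispatch on the kernel's branches); `flip_sub`, `QZ_flip`, `rowZ_flip`, `flip_zero`,
  `barlowPair_true_iff`, `signs8_cases`, `barlowPair_flip`, `okPair_flip` (the sign normal form preserves every datum);
* **`exists_menu_core`** — `Q(u) = 12` and three module vectors `a, b, c` with `2⟪u, m⟫_D = Q(m)`, `{0, a, b, c}` pairwise separated
  (`Q(Δ) ≥ 12`) and pairwise Barlow-consistent, force `u ∈ S18` (the eighteen unit module vectors).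
The geometric statement for Barlow windows is `…ModuleContactsBarlow`.
WHAT THIS IS NOT: not the geometry; not the stub; F-C1 not moved.
-/

noncomputable section

namespace Summit.Ventures.Crystal3D.Theorems

namespace ModuleContacts

open Summit.Ventures.Crystal3D Finset
open LatticeContacts (dotR)
open scoped InnerProductSpace

/-! ### §3 From the kernel table to the unit module vector -/

section Core

variable {u0 u1 u2 : ℝ}

/-- Unpacking the pair filter. -/
theorem okPair_iff (p q : V3) : okPair p q = true ↔ 12 ≤ QZ (subZ p q) ∧ QZ (subZ p q) ≤ 48 ∧ barlowPair p q = true := by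
  simp only [okPair, Bool.and_eq_true, decide_eq_true_eq, and_assoc]

/-- **Dispatch**: a passing kernel check, the pair filters and the real equations put `u` on a unit module vector. -/
theorem exists_menu_of_check {a b c : V3} (h : check a b c = true) (hu : 3 * u0 ^ 2 + u1 ^ 2 + 2 * u2 ^ 2 = 12)
    (ha : 2 * dotR u0 u1 u2 (rowZ a) = (QZ a : ℝ)) (hb : 2 * dotR u0 u1 u2 (rowZ b) = (QZ b : ℝ))
    (hc : 2 * dotR u0 u1 u2 (rowZ c) = (QZ c : ℝ))
    (hok : okPair (0, 0, 0) a = true ∧ okPair (0, 0, 0) b = true ∧ okPair (0, 0, 0) c = true ∧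
      okPair a b = true ∧ okPair a c = true ∧ okPair b c = true) :
    ∃ σ ∈ S18, u0 = (σ.1 : ℝ) ∧ u1 = (σ.2.1 : ℝ) ∧ u2 = (σ.2.2 : ℝ) := by
  have hok' := hok
  obtain ⟨-, -, -, hab, hac, hbc⟩ := hok'
  have h2 : ¬ (a = b ∨ a = c ∨ b = c) := by
    push Not
    exact ⟨ne_of_sep ((okPair_iff a b).1 hab).1, ne_of_sep ((okPair_iff a c).1 hac).1, ne_of_sep ((okPair_iff b c).1 hbc).1⟩
  unfold check at h
  rw [if_neg (not_not.2 hok), if_neg h2] at h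
  split_ifs at h with hd hn1 hn2
  · exact exists_menu_of_fullCheck hd h hu ha hb hc
  · exact exists_menu_of_rank2Check hn1 h hu ha hb hc
  · exact exists_menu_of_rank2Check hn2 h hu ha hc hb

/-- Sign flips distribute over differences. -/
theorem flip_sub (e p q : V3) : flipZ e (subZ p q) = subZ (flipZ e p) (flipZ e q) := by
  simp only [flipZ, subZ, Prod.mk.injEq]; exact ⟨by ring, by ring, by ring⟩

/-- Sign flips preserve `Q`. -/
theorem QZ_flip {e : V3} (he : e ∈ signs8) (p : V3) : QZ (flipZ e p) = QZ p := by
  obtain ⟨h1, h2, h3⟩ := signs8_sq e he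
  simp only [QZ, flipZ]
  linear_combination (3 * p.1 * p.1) * h1 + (p.2.1 * p.2.1) * h2 + (2 * p.2.2 * p.2.2) * h3

/-- Sign flips commute with the rows. -/
theorem rowZ_flip (e p : V3) : rowZ (flipZ e p) = flipZ e (rowZ p) := by
  simp only [rowZ, flipZ, Prod.mk.injEq]; exact ⟨by ring, trivial, by ring⟩

/-- The origin is fixed by sign flips. -/
theorem flip_zero (e : V3) : flipZ e (0, 0, 0) = (0, 0, 0) := by
  simp [flipZ]

/-- Barlow consistency, unpacked. -/
theorem barlowPair_true_iff (p q : V3) : barlowPair p q = true ↔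
    ((q.2.2 - p.2.2 = 0 → (q.2.1 - p.2.1) % 3 = 0) ∧
      ((q.2.2 - p.2.2 = 2 ∨ q.2.2 - p.2.2 = -2) → (q.2.1 - p.2.1) % 3 ≠ 0)) := by
  unfold barlowPair
  split_ifs with h1 h2
  · simp only [beq_iff_eq, h1, true_implies]
    constructor
    · intro h; exact ⟨h, fun h' => by omega⟩
    · intro h; exact h.1
  · simp only [bne_iff_ne, ne_eq, h1, false_implies, true_and, h2, true_implies]
  · simp only [h1, h2, false_implies, and_self]

/-- The sign entries of a sign vector. -/
theorem signs8_cases : ∀ e ∈ signs8, (e.2.1 = 1 ∨ e.2.1 = -1) ∧ (e.2.2 = 1 ∨ e.2.2 = -1) := by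
  decide

/-- Sign flips preserve Barlow consistency. -/
theorem barlowPair_flip {e : V3} (he : e ∈ signs8) {p q : V3} (h : barlowPair p q = true) :
    barlowPair (flipZ e p) (flipZ e q) = true := by
  rw [barlowPair_true_iff] at h ⊢
  obtain ⟨hA, hB⟩ := h
  obtain ⟨h2, h3⟩ := signs8_cases e he
  simp only [flipZ]
  rcases h2 with h2 | h2 <;> rcases h3 with h3 | h3 <;> rw [h2, h3] <;> constructor <;> intro h' <;> omega

/-- Sign flips preserve the pair filter. -/
theorem okPair_flip {e : V3} (he : e ∈ signs8) {p q : V3} (h : okPair p q = true) :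
    okPair (flipZ e p) (flipZ e q) = true := by
  rw [okPair_iff] at h ⊢
  rw [← flip_sub, QZ_flip he]
  exact ⟨h.1, h.2.1, barlowPair_flip he h.2.2⟩

/-- **THE CORE THEOREM (integer module coordinates).**  If `u ∈ ℝ³` has `Q(u) = 12` and three module vectors `a, b, c` with
`2 ⟪u, a⟫_D = Q(a)`, `2 ⟪u, b⟫_D = Q(b)`, `2 ⟪u, c⟫_D = Q(c)` are such that `0, a, b, c` are pairwise separated (`Q(Δ) ≥ 12`) and pairwise
Barlow-consistent, then `u` is one of the eighteen unit module vectors. -/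
theorem exists_menu_core (hu : 3 * u0 ^ 2 + u1 ^ 2 + 2 * u2 ^ 2 = 12) {a b c : V3}
    (ham : (a.1 - a.2.1) % 2 = 0 ∧ a.2.2 % 2 = 0) (hbm : (b.1 - b.2.1) % 2 = 0 ∧ b.2.2 % 2 = 0)
    (hcm : (c.1 - c.2.1) % 2 = 0 ∧ c.2.2 % 2 = 0)
    (ha12 : 12 ≤ QZ a) (hb12 : 12 ≤ QZ b) (hc12 : 12 ≤ QZ c)
    (hab : 12 ≤ QZ (subZ a b)) (hac : 12 ≤ QZ (subZ a c)) (hbc : 12 ≤ QZ (subZ b c))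
    (hBa : barlowPair (0, 0, 0) a = true) (hBb : barlowPair (0, 0, 0) b = true) (hBc : barlowPair (0, 0, 0) c = true)
    (hBab : barlowPair a b = true) (hBac : barlowPair a c = true) (hBbc : barlowPair b c = true)
    (ha : 2 * dotR u0 u1 u2 (rowZ a) = (QZ a : ℝ)) (hb : 2 * dotR u0 u1 u2 (rowZ b) = (QZ b : ℝ))
    (hc : 2 * dotR u0 u1 u2 (rowZ c) = (QZ c : ℝ)) :
    ∃ σ ∈ S18, u0 = (σ.1 : ℝ) ∧ u1 = (σ.2.1 : ℝ) ∧ u2 = (σ.2.2 : ℝ) := by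
  have ha48 := QZ_le_48 hu ha
  have hb48 := QZ_le_48 hu hb
  have hc48 := QZ_le_48 hu hc
  have haT := mem_T146 a ham ha12 ha48
  have hbT := mem_T146 b hbm hb12 hb48
  have hcT := mem_T146 c hcm hc12 hc48
  -- the six pair filters
  have hQ0 : ∀ v : V3, QZ (subZ (0, 0, 0) v) = QZ v := fun v => by simp only [QZ, subZ]; ring
  have hoka : okPair (0, 0, 0) a = true := (okPair_iff _ _).2 ⟨by rw [hQ0]; exact ha12, by rw [hQ0]; exact ha48, hBa⟩
  have hokb : okPair (0, 0, 0) b = true := (okPair_iff _ _).2 ⟨by rw [hQ0]; exact hb12, by rw [hQ0]; exact hb48, hBb⟩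
  have hokc : okPair (0, 0, 0) c = true := (okPair_iff _ _).2 ⟨by rw [hQ0]; exact hc12, by rw [hQ0]; exact hc48, hBc⟩
  have hokab : okPair a b = true := (okPair_iff _ _).2 ⟨hab, QZ_sub_le_48 hu ha hb, hBab⟩
  have hokac : okPair a c = true := (okPair_iff _ _).2 ⟨hac, QZ_sub_le_48 hu ha hc, hBac⟩
  have hokbc : okPair b c = true := (okPair_iff _ _).2 ⟨hbc, QZ_sub_le_48 hu hb hc, hBbc⟩
  -- sign normal form
  obtain ⟨e, he, hea⟩ := exists_flip_mem_reps29 a haT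
  obtain ⟨h1, h2, h3⟩ := signs8_sq e he
  have h1' : ((e.1 : ℝ)) * e.1 = 1 := by exact_mod_cast h1
  have h2' : ((e.2.1 : ℝ)) * e.2.1 = 1 := by exact_mod_cast h2
  have h3' : ((e.2.2 : ℝ)) * e.2.2 = 1 := by exact_mod_cast h3
  have hu' : 3 * ((e.1 : ℝ) * u0) ^ 2 + ((e.2.1 : ℝ) * u1) ^ 2 + 2 * ((e.2.2 : ℝ) * u2) ^ 2 = 12 := by
    linear_combination hu + (3 * u0 ^ 2) * h1' + (u1 ^ 2) * h2' + (2 * u2 ^ 2) * h3'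
  have heq : ∀ {m : V3}, 2 * dotR u0 u1 u2 (rowZ m) = (QZ m : ℝ) →
      2 * dotR (e.1 * u0) (e.2.1 * u1) (e.2.2 * u2) (rowZ (flipZ e m)) = (QZ (flipZ e m) : ℝ) := by
    intro m hm
    have hflip : dotR (e.1 * u0) (e.2.1 * u1) (e.2.2 * u2) (flipZ e (rowZ m)) = dotR u0 u1 u2 (rowZ m) := by
      simp only [dotR, flipZ]; push_cast
      linear_combination (u0 * (rowZ m).1) * h1' + (u1 * (rowZ m).2.1) * h2' + (u2 * (rowZ m).2.2) * h3'
    rw [rowZ_flip, hflip, QZ_flip he]; exact hm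
  have hoka' : okPair (0, 0, 0) (flipZ e a) = true := by have := okPair_flip he hoka; rwa [flip_zero] at this
  have hokb' : okPair (0, 0, 0) (flipZ e b) = true := by have := okPair_flip he hokb; rwa [flip_zero] at this
  have hokc' : okPair (0, 0, 0) (flipZ e c) = true := by have := okPair_flip he hokc; rwa [flip_zero] at this
  have key := table (flipZ e a) hea (flipZ e b) (flip_mem_T146 e he b hbT) hoka' hokb' (okPair_flip he hokab)
    (flipZ e c) (flip_mem_T146 e he c hcT)
  obtain ⟨σ, hσ, f0, f1, f2⟩ := exists_menu_of_check key hu' (heq ha) (heq hb) (heq hc)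
    ⟨hoka', hokb', hokc', okPair_flip he hokab, okPair_flip he hokac, okPair_flip he hokbc⟩
  refine ⟨flipZ e σ, flip_mem_S18 e he σ hσ, ?_, ?_, ?_⟩
  · simp only [flipZ]; push_cast; rw [← f0]; linear_combination (-u0) * h1'
  · simp only [flipZ]; push_cast; rw [← f1]; linear_combination (-u1) * h2'
  · simp only [flipZ]; push_cast; rw [← f2]; linear_combination (-u2) * h3'

end Core

end ModuleContacts

end Summit.Ventures.Crystal3D.Theorems

end
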